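/-
HONEST FRAMING: certified error envelopes and provably optimal rounding/accumulation schemes for
low-precision formats under stated cost models; every table by two implementations; no hardware
or vendor claims.
-/
import Summits.Ventures.CertifiedArithmetic.LowPrec.OptDemotionWitness
import Summits.Ventures.CertifiedArithmetic.LowPrec.AccumulateTree

/-!
# The demotion law (Theorem T8), part 3: Conjecture D for the balanced four-leaf tree

OPTIMA.md §B Theorem T8: a summation tree evaluated in the WIDE format `F(q, emin)` (one nearest
rounding per addition) whose root is rounded ONCE to the NARROW format `F(p, emin)`.  Part 1
(`OptDemotion`) proved the exact law `1 + u_p + (n-1)u_q` for recursive summation; part 2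
(`OptDemotionWitness`) the product bound `(1+u_p)·M_t(u_q)` for every tree, which is NOT sharp; the
exact constant of a general tree is opt's coupled tree polynomial `Q_t` — equal to the certified
worst case `D_t` on all 114 exhaustively certified rows (C20), and stated for every tree as
CONJECTURE D ("the upper-bound half for non-chain trees is open").

THIS FILE proves Conjecture D's upper bound for the first non-chain tree, the balanced four-leaf
tree `((a,b),(c,d))`, at EVERY pair of precisions:

  **`a + b + c + d ≤ (1 + u_p + 2u_q + u_p·u_q) · fl_p(fl_q(fl_q(a+b) + fl_q(c+d)))`**

(`exact_le_demotion_balanced4`; all `p ≥ 1`, `q ≥ p + 1`, ANY nearest roundings `fl_q`, `fl_p`,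
nonnegative data of `F(q, emin)`, gradual underflow included).  `Q = 1 + u_p + 2u_q + u_p u_q` is
opt's `Q` of this tree (`max(Q_pair + u_q M_pair, M_pair + u_p R_pair)` with `Q_pair = 1+u_p+u_q`,
`R_pair = 1+w+u_q`, `M_pair = 1+u_q`) and T5(g)'s certified `305/256` at `(q,p) = (5,3)`
(`demotion_balanced4_constants`); it is strictly below the product bound `(1+u_p)(1+u_q)²`.  The
bound is ATTAINED (ties-to-even, `q ≥ p + 2`, `p ≥ 2`) by the leaves `(2^e, 2^e u_q)`,
`(2^e u_p, 2^e u_q(1+u_p))` — opt's typed witness of T8(b)(ii) — kernel-checked here in the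
realistic instance "accumulate in binary16, store bfloat16" (`q = 11`, `p = 8`, `e = 0`:
`demotion_balanced4_attained_fp16_bf16`, ratio exactly `1 + 2^-8 + 2^-10 + 2^-19`).

PROOF (the chain argument of part 1 plus ONE structural observation).  With `2^K ≤ ŝ < 2^(K+1)`
every one of the three wide additions loses at most `u_q 2^K` and the demotion at most `u_p 2^K`
— that alone gives `1 + u_p + 3u_q`, too weak.  The observation: the two leaf pairs cannot BOTH be
heavy.  If `fl_q(a+b) ≥ 2^K` then `fl_q(c+d) ≤ ŝ + u_q 2^K - 2^K`, so when `ŝ ≤ (1+u_p)2^K` (the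
only place where the demotion can lose a full `u_p 2^K` relative to `2^K`) the light pair lives
below `2(u_p 2^K)` and loses at most `u_q·u_p·2^K` — whence `u_p + 2u_q + u_p u_q`; if neither pair
reaches `2^K` both lose at most `u_q 2^(K-1)`.  Above `(1+u_p)2^K` the demoted value is at least
`(1+2u_p)2^K` (gap above a power of two, `pow_add_gap_le_of_lt`) and the slack absorbs the light
pair's `u_q·(its own magnitude)`.
-/

namespace Summit.Ventures.CertifiedArithmetic.LowPrec.Opt

open Literature.ComputerArithmetic.JeannerodRump2018

/-! ## §1 Three small facts in the Jeannerod–Rump model -/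

/-- `u_q < u_p` for `p < q`. -/
theorem unitRoundoff_lt_of_lt {p q : ℕ} (h : p < q) : unitRoundoff q < unitRoundoff p := by
  unfold unitRoundoff
  apply one_div_lt_one_div_of_lt (by positivity)
  exact pow_lt_pow_right₀ (by norm_num) h

/-- ONE ADDITION of two nonnegative floats of `F(q, emin)` whose result is `< 2^(K+1)` loses at most
`u_q·2^K` (nothing below the underflow threshold) — `chain_deficit_le` with one summand. -/
theorem pair_deficit_le {q : ℕ} (hq : 1 ≤ q) {emin : ℤ} {fl : ℚ → ℚ}
    (hfl : IsRoundNearest q emin fl) {x y : ℚ} (hx : IsFloat q emin x) (hy : IsFloat q emin y)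
    (hx0 : 0 ≤ x) (hy0 : 0 ≤ y) (K : ℤ) (hK : fl (x + y) < (2 : ℚ) ^ (K + 1)) :
    x + y - fl (x + y) ≤ unitRoundoff q * (2 : ℚ) ^ K := by
  have h := chain_deficit_le hq hfl [y] x hx hx0
    (by intro z hz; simp only [List.mem_singleton] at hz; subst hz; exact ⟨hy, hy0⟩) K
    (by simpa using hK)
  simpa using h

/-- One addition of nonnegative floats loses at most `u_q` times its RESULT. -/
theorem pair_deficit_le_mul {q : ℕ} (hq : 1 ≤ q) {emin : ℤ} {fl : ℚ → ℚ}
    (hfl : IsRoundNearest q emin fl) {x y : ℚ} (hx : IsFloat q emin x) (hy : IsFloat q emin y)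
    (hx0 : 0 ≤ x) (hy0 : 0 ≤ y) :
    x + y - fl (x + y) ≤ unitRoundoff q * fl (x + y) := by
  have hxle : x ≤ fl (x + y) := le_fl_of_isFloat_le hfl hx (by linarith)
  have hyle : y ≤ fl (x + y) := le_fl_of_isFloat_le hfl hy (by linarith)
  rcases eq_or_lt_of_le (le_trans hx0 hxle) with h0 | hpos
  · -- result 0: both summands are 0
    have hx' : x = 0 := le_antisymm (by linarith) hx0
    have hy' : y = 0 := le_antisymm (by linarith) hy0
    rw [← h0]; rw [hx', hy']; simp
  · set K := Int.log 2 (fl (x + y)) with hK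
    have hlow : ((2 : ℕ) : ℚ) ^ K ≤ fl (x + y) := Int.zpow_log_le_self (by norm_num) hpos
    have hup : fl (x + y) < ((2 : ℕ) : ℚ) ^ (K + 1) := Int.lt_zpow_succ_log_self (by norm_num) _
    push_cast at hlow hup
    have h := pair_deficit_le hq hfl hx hy hx0 hy0 K hup
    exact le_trans h (mul_le_mul_of_nonneg_left hlow (unitRoundoff_nonneg q))

/-- An addition of nonnegative floats below the underflow threshold `2^(emin+q)` is exact. -/
theorem pair_exact_of_small {q : ℕ} (hq : 1 ≤ q) {emin : ℤ} {fl : ℚ → ℚ}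
    (hfl : IsRoundNearest q emin fl) {x y : ℚ} (hx : IsFloat q emin x) (hy : IsFloat q emin y)
    (hx0 : 0 ≤ x) (hy0 : 0 ≤ y) (h : fl (x + y) < (2 : ℚ) ^ (emin + q)) : fl (x + y) = x + y := by
  have h' := chainEval_eq_exact_of_small hq hfl [y] x hx hx0
    (by intro z hz; simp only [List.mem_singleton] at hz; subst hz; exact ⟨hy, hy0⟩)
    (by simpa using h)
  simpa using h'

/-- GAP ABOVE A POWER OF TWO: a float of `F(p, emin)` exceeding `2^K` is at least
`2^K + 2^(K+1-p) = 2^K(1 + 2u_p)` (`p ≥ 1`). -/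
theorem pow_add_gap_le_of_lt {p : ℕ} (hp : 1 ≤ p) {emin : ℤ} {f : ℚ} (hf : IsFloat p emin f)
    {K : ℤ} (hlt : (2 : ℚ) ^ K < f) :
    (2 : ℚ) ^ K + (2 : ℚ) ^ (K + 1 - p) ≤ f := by
  obtain ⟨M, e, hM, _he, rfl⟩ := hf
  have h2 : (2 : ℚ) ≠ 0 := by norm_num
  have h2e : (0 : ℚ) < (2 : ℚ) ^ e := zpow_pos (by norm_num) _
  have h2K : (0 : ℚ) < (2 : ℚ) ^ K := zpow_pos (by norm_num) _
  have hM0 : 0 < M := by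
    by_contra h
    have h' : (M : ℚ) ≤ 0 := by exact_mod_cast not_lt.mp h
    have : (M : ℚ) * (2 : ℚ) ^ e ≤ 0 := mul_nonpos_of_nonpos_of_nonneg h' h2e.le
    linarith
  have hMp : (M : ℚ) < 2 ^ p := by
    have h1 := hM; rw [abs_of_pos hM0] at h1; exact_mod_cast h1
  rcases le_or_gt e (K - p) with hle | hgt
  · exfalso
    have h1 : (M : ℚ) * 2 ^ e < 2 ^ p * 2 ^ e := mul_lt_mul_of_pos_right hMp h2e
    have h3 : (2 : ℚ) ^ p * 2 ^ e = (2 : ℚ) ^ ((p : ℤ) + e) := by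
      rw [zpow_add₀ h2, zpow_natCast]
    have h4 : (2 : ℚ) ^ ((p : ℤ) + e) ≤ 2 ^ K := zpow_le_zpow_right₀ (by norm_num) (by omega)
    linarith
  · obtain ⟨dd, hdd⟩ : ∃ dd : ℕ, e = (K + 1 - p) + dd := ⟨(e - (K + 1 - p)).toNat, by omega⟩
    set c : ℚ := (2 : ℚ) ^ (K + 1 - (p : ℤ)) with hc
    have hcpos : 0 < c := zpow_pos (by norm_num) _
    have hp1 : ((p - 1 : ℕ) : ℤ) = (p : ℤ) - 1 := by omega
    have hK : (2 : ℚ) ^ K = ((2 ^ (p - 1) : ℤ) : ℚ) * c := by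
      push_cast
      rw [hc, ← zpow_natCast, hp1, ← zpow_add₀ h2]; congr 1; ring
    have hf : (M : ℚ) * 2 ^ e = ((M * 2 ^ dd : ℤ) : ℚ) * c := by
      rw [hdd, zpow_add₀ h2, zpow_natCast]; push_cast; ring
    have hlt' : (2 : ℤ) ^ (p - 1) < M * 2 ^ dd := by
      have h1 : ((2 ^ (p - 1) : ℤ) : ℚ) * c < ((M * 2 ^ dd : ℤ) : ℚ) * c := by
        rw [← hf, ← hK]; exact hlt
      exact_mod_cast lt_of_mul_lt_mul_right h1 hcpos.le
    have hle' : (2 : ℤ) ^ (p - 1) + 1 ≤ M * 2 ^ dd := hlt'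
    have h5 : (((2 : ℤ) ^ (p - 1) + 1 : ℤ) : ℚ) * c ≤ ((M * 2 ^ dd : ℤ) : ℚ) * c :=
      mul_le_mul_of_nonneg_right (by exact_mod_cast hle') hcpos.le
    rw [← hf] at h5
    have hsplit : (((2 : ℤ) ^ (p - 1) + 1 : ℤ) : ℚ) * c = 2 ^ K + c := by
      rw [hK]; push_cast; ring
    linarith

/-! ## §2 Conjecture D for the balanced four-leaf tree -/

/-- ONE ORIENTATION (the pair `(a,b)` computes the larger value). -/
theorem exact_le_demotion_balanced4_of_le {p q : ℕ} (hp : 1 ≤ p) (hpq : p + 1 ≤ q) {emin : ℤ}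
    {flq flp : ℚ → ℚ} (hflq : IsRoundNearest q emin flq) (hflp : IsRoundNearest p emin flp)
    {a b c d : ℚ} (ha : IsFloat q emin a) (hb : IsFloat q emin b) (hc : IsFloat q emin c)
    (hd : IsFloat q emin d) (ha0 : 0 ≤ a) (hb0 : 0 ≤ b) (hc0 : 0 ≤ c) (hd0 : 0 ≤ d)
    (hCA : flq (c + d) ≤ flq (a + b)) :
    a + b + c + d ≤ (1 + unitRoundoff p + 2 * unitRoundoff q + unitRoundoff p * unitRoundoff q)
        * flp (flq (flq (a + b) + flq (c + d))) := by
  have hq : 1 ≤ q := by omega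
  have h2 : (2 : ℚ) ≠ 0 := by norm_num
  set u := unitRoundoff q with hu
  set P := unitRoundoff p with hP
  have hu0 : 0 ≤ u := unitRoundoff_nonneg q
  have hP0 : 0 ≤ P := unitRoundoff_nonneg p
  have huP : u < P := unitRoundoff_lt_of_lt (by omega)
  set A := flq (a + b) with hA
  set C := flq (c + d) with hC
  set S := flq (A + C) with hS
  have hAF : IsFloat q emin A := (hflq _).1
  have hCF : IsFloat q emin C := (hflq _).1
  have hSF : IsFloat q emin S := (hflq _).1
  have haA : a ≤ A := le_fl_of_isFloat_le hflq ha (by linarith)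
  have hcC : c ≤ C := le_fl_of_isFloat_le hflq hc (by linarith)
  have hA0 : 0 ≤ A := le_trans ha0 haA
  have hC0 : 0 ≤ C := le_trans hc0 hcC
  have hAS : A ≤ S := le_fl_of_isFloat_le hflq hAF (by linarith)
  have hCS : C ≤ S := le_fl_of_isFloat_le hflq hCF (by linarith)
  have hS0 : 0 ≤ S := le_trans hA0 hAS
  by_cases hsmall : S < (2 : ℚ) ^ (emin + p)
  · -- below the demotion threshold: all four roundings are exact
    have hsmallq : S < (2 : ℚ) ^ (emin + q) :=
      lt_of_lt_of_le hsmall (zpow_le_zpow_right₀ (by norm_num) (by omega))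
    have hAex : A = a + b := pair_exact_of_small hq hflq ha hb ha0 hb0 (lt_of_le_of_lt hAS hsmallq)
    have hCex : C = c + d := pair_exact_of_small hq hflq hc hd hc0 hd0 (lt_of_le_of_lt hCS hsmallq)
    have hSex : S = A + C := pair_exact_of_small hq hflq hAF hCF hA0 hC0 hsmallq
    have hrex : flp S = S := fl_eq_self hflp (isFloat_narrow_of_small hSF hS0 hsmall)
    rw [hrex, hSex, hAex, hCex]
    have hs0 : 0 ≤ a + b + (c + d) := by linarith
    nlinarith [mul_nonneg hP0 hs0, mul_nonneg hu0 hs0, mul_nonneg (mul_nonneg hP0 hu0) hs0]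
  · -- demotion in the normal range of `F_p`: the binade `2^K ≤ S < 2^(K+1)`
    have hbig : (2 : ℚ) ^ (emin + p) ≤ S := not_lt.mp hsmall
    have hpos : 0 < S := lt_of_lt_of_le (zpow_pos (by norm_num) _) hbig
    set K := Int.log 2 S with hK
    have hlow : ((2 : ℕ) : ℚ) ^ K ≤ S := Int.zpow_log_le_self (by norm_num) hpos
    have hupK : S < ((2 : ℕ) : ℚ) ^ (K + 1) := Int.lt_zpow_succ_log_self (by norm_num) _
    push_cast at hlow hupK
    have hKe : emin + p ≤ K + 1 := by
      by_contra hlt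
      have : (2 : ℚ) ^ (K + 1) ≤ (2 : ℚ) ^ (emin + (p : ℤ)) :=
        zpow_le_zpow_right₀ (by norm_num) (by omega)
      linarith
    have h2K : (0 : ℚ) < (2 : ℚ) ^ K := zpow_pos (by norm_num) _
    set T : ℚ := (2 : ℚ) ^ K with hT
    have herr := abs_sub_fl_le_half_ulp hp hflp hlow hupK hKe
    have hr_ge : T ≤ flp S :=
      le_fl_of_isFloat_le hflp (PTree.isFloat_two_zpow hp (by omega)) hlow
    have hSr : S - flp S ≤ P * T := le_trans (le_abs_self _) herr
    -- the three wide additions at scale 2^K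
    have hg : A + C - S ≤ u * T := pair_deficit_le hq hflq hAF hCF hA0 hC0 K hupK
    have h1 : a + b - A ≤ u * T := pair_deficit_le hq hflq ha hb ha0 hb0 K (lt_of_le_of_lt hAS hupK)
    -- useful identities
    have hTP : (2 : ℚ) ^ (K - (p : ℤ)) = T * P := PTree.two_zpow_sub_prec p K
    have hThalf : (2 : ℚ) ^ (K - 1) = T / 2 := by rw [zpow_sub_one₀ h2]; ring
    by_cases hS1 : S ≤ (1 + P) * T
    · -- REGIME 1: the demotion may go down to 2^K; show s ≤ Q·2^K
      suffices hmain : a + b + c + d ≤ (1 + P + 2 * u + P * u) * T by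
        have hQ0 : 0 ≤ 1 + P + 2 * u + P * u := by nlinarith
        calc a + b + c + d ≤ (1 + P + 2 * u + P * u) * T := hmain
          _ ≤ (1 + P + 2 * u + P * u) * flp S := mul_le_mul_of_nonneg_left hr_ge hQ0
          _ = _ := by ring
      rcases le_or_gt T A with hAbig | hAsmall
      · -- the pair (a,b) is heavy, so (c,d) is light: C ≤ (P+u)·2^K < 2·(P 2^K)
        have hCle : C ≤ (P + u) * T := by linarith
        have hClt : C < (2 : ℚ) ^ ((K - p) + 1) := by
          rw [zpow_add_one₀ h2, hTP]
          have : u * T < P * T := mul_lt_mul_of_pos_right huP h2K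
          linarith
        have h2' : c + d - C ≤ u * (T * P) := by
          have := pair_deficit_le hq hflq hc hd hc0 hd0 (K - p) hClt; rwa [hTP] at this
        linarith
      · -- both pairs are light: each loses at most u·2^(K-1)
        have hCsmall : C < T := lt_of_le_of_lt hCA hAsmall
        have h1' : a + b - A ≤ u * (T / 2) := by
          have := pair_deficit_le hq hflq ha hb ha0 hb0 (K - 1) (by rw [sub_add_cancel]; exact hAsmall)
          rwa [hThalf] at this
        have h2' : c + d - C ≤ u * (T / 2) := by
          have := pair_deficit_le hq hflq hc hd hc0 hd0 (K - 1) (by rw [sub_add_cancel]; exact hCsmall)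
          rwa [hThalf] at this
        have hPuT : 0 ≤ P * u * T := by positivity
        linarith
    · -- REGIME 2: S > (1+P)·2^K, so the demoted value is at least (1+2P)·2^K
      have hS1' : (1 + P) * T < S := not_le.mp hS1
      have hgap : (2 : ℚ) ^ (K + 1 - (p : ℤ)) = 2 * (T * P) := by
        rw [show K + 1 - (p : ℤ) = (K - p) + 1 by ring, zpow_add_one₀ h2, hTP]; ring
      have hf1F : IsFloat p emin (T + (2 : ℚ) ^ (K + 1 - (p : ℤ))) := by
        rcases Nat.lt_or_ge p 2 with hp1 | hp2
        · -- p = 1: the value is the power of two 2^(K+1)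
          have hp' : p = 1 := by omega
          subst hp'
          have : T + (2 : ℚ) ^ (K + 1 - ((1 : ℕ) : ℤ)) = (2 : ℚ) ^ (K + 1) := by
            rw [hT, show K + 1 - ((1 : ℕ) : ℤ) = K by simp, zpow_add_one₀ h2]; ring
          rw [this]; exact PTree.isFloat_two_zpow hp (by omega)
        · refine ⟨2 ^ (p - 1) + 1, K + 1 - p, ?_, by omega, ?_⟩
          · rw [abs_of_nonneg (by positivity)]
            have h3 : (2 : ℤ) ≤ 2 ^ (p - 1) :=
              calc (2 : ℤ) = 2 ^ 1 := by norm_num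
                _ ≤ 2 ^ (p - 1) := pow_le_pow_right₀ (by norm_num) (by omega)
            have h4 : (2 : ℤ) ^ p = 2 * 2 ^ (p - 1) := by
              rw [← pow_succ']; congr 1; omega
            rw [h4]; omega
          · have hp1 : ((p - 1 : ℕ) : ℤ) = (p : ℤ) - 1 := by omega
            push_cast
            rw [add_mul, one_mul, ← zpow_natCast, hp1, ← zpow_add₀ h2, hT]
            congr 1; ring_nf
      have hr_ge2 : T + 2 * (T * P) ≤ flp S := by
        rw [← hgap]
        rcases le_or_gt (T + (2 : ℚ) ^ (K + 1 - (p : ℤ))) S with hle | hgt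
        · exact le_fl_of_isFloat_le hflp hf1F hle
        · have hrF : IsFloat p emin (flp S) := (hflp S).1
          rcases le_or_gt (flp S) T with hrle | hrgt
          · exfalso
            have hnear := (hflp S).2 _ hf1F
            rw [abs_of_nonneg (by linarith : 0 ≤ S - flp S),
              abs_of_nonpos (by linarith : S - (T + (2 : ℚ) ^ (K + 1 - (p : ℤ))) ≤ 0)] at hnear
            rw [hgap] at hnear
            linarith
          · exact pow_add_gap_le_of_lt hp hrF hrgt
      rcases le_or_gt T A with hAbig | hAsmall
      · -- heavy (a,b), light (c,d): (c,d) loses at most u·C ≤ u(S + u2^K - 2^K)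
        have h2' : c + d - C ≤ u * C := pair_deficit_le_mul hq hflq hc hd hc0 hd0
        have hCle : C ≤ S + u * T - T := by linarith
        have i1 : u * C ≤ u * (S + u * T - T) := mul_le_mul_of_nonneg_left hCle hu0
        have i2 : u * S ≤ u * (flp S + P * T) := mul_le_mul_of_nonneg_left (by linarith) hu0
        have i3 : P * (T + 2 * (T * P)) ≤ P * flp S := mul_le_mul_of_nonneg_left hr_ge2 hP0
        have i4 : u * (T + 2 * (T * P)) ≤ u * flp S := mul_le_mul_of_nonneg_left hr_ge2 hu0
        have i5 : (P * u) * (T + 2 * (T * P)) ≤ (P * u) * flp S :=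
          mul_le_mul_of_nonneg_left hr_ge2 (mul_nonneg hP0 hu0)
        have i6 : u * (u * T) ≤ P * (u * T) :=
          mul_le_mul_of_nonneg_right huP.le (mul_nonneg hu0 h2K.le)
        have i7 : 0 ≤ P * P * T := by positivity
        have i8 : 0 ≤ P * P * u * T := by positivity
        have i9 : 0 ≤ P * u * T := by positivity
        have hs : a + b + c + d ≤ S + u * T + u * S + u * (u * T) := by linarith
        have hs' : a + b + c + d
            ≤ flp S + u * flp S + P * T + u * T + u * P * T + u * (u * T) := by linarith
        linarith
      · have hCsmall : C < T := lt_of_le_of_lt hCA hAsmall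
        have h1' : a + b - A ≤ u * (T / 2) := by
          have := pair_deficit_le hq hflq ha hb ha0 hb0 (K - 1) (by rw [sub_add_cancel]; exact hAsmall)
          rwa [hThalf] at this
        have h2' : c + d - C ≤ u * (T / 2) := by
          have := pair_deficit_le hq hflq hc hd hc0 hd0 (K - 1) (by rw [sub_add_cancel]; exact hCsmall)
          rwa [hThalf] at this
        have i3 : P * T ≤ P * flp S := mul_le_mul_of_nonneg_left hr_ge hP0
        have i4 : u * T ≤ u * flp S := mul_le_mul_of_nonneg_left hr_ge hu0
        have i5 : 0 ≤ (P * u) * flp S := mul_nonneg (mul_nonneg hP0 hu0) (le_trans h2K.le hr_ge)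
        linarith

/-- **CONJECTURE D FOR THE BALANCED FOUR-LEAF TREE** (OPTIMA.md §B T8(b)(iii), first non-chain
case, every pair of precisions): nonnegative data `a, b, c, d ∈ F(q, emin)`, the tree
`((a,b),(c,d))` evaluated with ANY nearest rounding `fl_q`, the root rounded once by ANY nearest
rounding `fl_p` into `F(p, emin)`, `p ≥ 1`, `q ≥ p + 1`:
`a + b + c + d ≤ (1 + u_p + 2u_q + u_p u_q) · fl_p(ŝ)`. -/
theorem exact_le_demotion_balanced4 {p q : ℕ} (hp : 1 ≤ p) (hpq : p + 1 ≤ q) {emin : ℤ}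
    {flq flp : ℚ → ℚ} (hflq : IsRoundNearest q emin flq) (hflp : IsRoundNearest p emin flp)
    {a b c d : ℚ} (ha : IsFloat q emin a) (hb : IsFloat q emin b) (hc : IsFloat q emin c)
    (hd : IsFloat q emin d) (ha0 : 0 ≤ a) (hb0 : 0 ≤ b) (hc0 : 0 ≤ c) (hd0 : 0 ≤ d) :
    a + b + c + d ≤ (1 + unitRoundoff p + 2 * unitRoundoff q + unitRoundoff p * unitRoundoff q)
        * flp (flq (flq (a + b) + flq (c + d))) := by
  rcases le_total (flq (c + d)) (flq (a + b)) with h | h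
  · exact exact_le_demotion_balanced4_of_le hp hpq hflq hflp ha hb hc hd ha0 hb0 hc0 hd0 h
  · have := exact_le_demotion_balanced4_of_le hp hpq hflq hflp hc hd ha hb hc0 hd0 ha0 hb0 h
    rw [add_comm (flq (c + d)) (flq (a + b))] at this
    linarith

/-- Relative form: the demoted balanced four-leaf tree under-estimates by at most
`1 - 1/(1 + u_p + 2u_q + u_p u_q)` of the exact sum. -/
theorem demotion_balanced4_relative {p q : ℕ} (hp : 1 ≤ p) (hpq : p + 1 ≤ q) {emin : ℤ}
    {flq flp : ℚ → ℚ} (hflq : IsRoundNearest q emin flq) (hflp : IsRoundNearest p emin flp)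
    {a b c d : ℚ} (ha : IsFloat q emin a) (hb : IsFloat q emin b) (hc : IsFloat q emin c)
    (hd : IsFloat q emin d) (ha0 : 0 ≤ a) (hb0 : 0 ≤ b) (hc0 : 0 ≤ c) (hd0 : 0 ≤ d) :
    (a + b + c + d) - flp (flq (flq (a + b) + flq (c + d)))
      ≤ (1 - 1 / (1 + unitRoundoff p + 2 * unitRoundoff q + unitRoundoff p * unitRoundoff q))
          * (a + b + c + d) := by
  have h := exact_le_demotion_balanced4 hp hpq hflq hflp ha hb hc hd ha0 hb0 hc0 hd0
  have hQ : 0 < 1 + unitRoundoff p + 2 * unitRoundoff q + unitRoundoff p * unitRoundoff q := by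
    have := unitRoundoff_nonneg p; have := unitRoundoff_nonneg q; positivity
  rw [sub_mul, one_mul, div_mul_eq_mul_div, one_mul, sub_le_sub_iff_left, div_le_iff₀ hQ]
  linarith

/-! ## §3 The constant, and attainment in a realistic pair of formats -/

/-- THE CONSTANT: `Q = 1 + u_p + 2u_q + u_p u_q` is opt's coupled tree polynomial of the balanced
four-leaf tree (`max(Q_pair + u_q·M_pair, M_pair + u_p·R_pair)`, the second option), strictly below
the product bound `(1+u_p)(1+u_q)²` of `exact_le_demotion_tree`; at `(q,p) = (5,3)` it is T5(g)'s
certified `305/256`, at `(q,p) = (11,8)` (binary16 accumulation demoted to bfloat16)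
`1 + 2^-8 + 2^-10 + 2^-19 = 526849/524288`. -/
theorem demotion_balanced4_constants :
    (1 + (1/8 : ℚ) + 2 * (1/32) + (1/8) * (1/32) : ℚ) = 305 / 256 ∧
    (305 / 256 : ℚ) < (1 + 1/8) * (1 + 1/32) ^ 2 ∧
    (1 + (1/256 : ℚ) + 2 * (1/2048) + (1/256) * (1/2048) : ℚ) = 526849 / 524288 ∧
    (∀ P u : ℚ, 0 < u → u < P →
      max ((1 + P + u) + u * (1 + u)) ((1 + u) + P * (1 + u / P + u)) = 1 + P + 2 * u + P * u ∧
      1 + P + 2 * u + P * u < (1 + P) * (1 + u) ^ 2) := by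
  refine ⟨by norm_num, by norm_num, by norm_num, fun P u hu huP => ⟨?_, ?_⟩⟩
  · have hP0 : 0 < P := lt_trans hu huP
    have hP : P ≠ 0 := hP0.ne'
    have h1 : (1 + u) + P * (1 + u / P + u) = 1 + P + 2 * u + P * u := by field_simp; ring
    rw [h1, max_eq_right]
    have : u * u ≤ P * u := by nlinarith
    nlinarith
  · have hP0 : 0 < P := lt_trans hu huP
    have e : (1 + P) * (1 + u) ^ 2 - (1 + P + 2 * u + P * u) = u * u + P * u + P * u * u := by ring
    have : 0 < u * u + P * u + P * u * u := by positivity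
    linarith

open Literature.ComputerArithmetic.FloatingPoint
open Literature.ComputerArithmetic.FloatingPoint.MiniFloat in
/-- **ATTAINED** (kernel): accumulate in binary16 (`q = 11`), store in bfloat16 (`p = 8`) — the
leaves `(1, 2^-11), (2^-8, 2^-11(1 + 2^-8))` are binary16 data, every wide addition is a tie
resolved to even (`1 + 2^-11 ↦ 1`, `2^-8 + 2^-11 + 2^-19 ↦ 2^-8 + 2^-11`,
`1 + 2^-8 + 2^-11 ↦ 1 + 2^-8`), the demotion is the tie `1 + 2^-8 ↦ 1`, and the exact sum is
`Q = 1 + 2^-8 + 2^-10 + 2^-19` times the result `1`: the bound of `exact_le_demotion_balanced4` is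
the exact worst case of this tree for this pair of formats. -/
theorem demotion_balanced4_attained_fp16_bf16 :
    flα Format.Binary16 (1 : ℚ) = 1 ∧ flα Format.Binary16 (1/2048 : ℚ) = 1/2048 ∧
    flα Format.Binary16 (1/256 : ℚ) = 1/256 ∧
    flα Format.Binary16 (1/2048 * (1 + 1/256) : ℚ) = 1/2048 * (1 + 1/256) ∧
    flα Format.Binary16 (1 + 1/2048) = 1 ∧
    flα Format.Binary16 (1/256 + 1/2048 * (1 + 1/256)) = 1/256 + 1/2048 ∧
    flα Format.Binary16 (1 + (1/256 + 1/2048)) = 1 + 1/256 ∧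
    flα Format.BFloat16 (1 + 1/256) = 1 ∧
    ((1 : ℚ) + 1/2048) + (1/256 + 1/2048 * (1 + 1/256))
      = (1 + 1/256 + 2 * (1/2048) + (1/256) * (1/2048)) * 1 := by
  refine ⟨by decide +kernel, by decide +kernel, by decide +kernel, by decide +kernel,
    by decide +kernel, by decide +kernel, by decide +kernel, by decide +kernel, by norm_num⟩

/-- R4/T8 (OPTIMA.md §B T8(b)(iii), Conjecture D — balanced four-leaf tree): for all `p ≥ 1`,
`q ≥ p + 1`, all nearest roundings `fl_q`, `fl_p`, all nonnegative wide-format data, the tree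
`((a,b),(c,d))` evaluated wide and demoted once has `s ≤ (1 + u_p + 2u_q + u_p u_q)·fl_p(ŝ)` (opt's
`Q`, attained under ties-to-even: `demotion_balanced4_attained_fp16_bf16`). -/
def R4_DemotionBalanced4 : Prop :=
  ∀ (p q : ℕ), 1 ≤ p → p + 1 ≤ q → ∀ (emin : ℤ) (flq flp : ℚ → ℚ),
    IsRoundNearest q emin flq → IsRoundNearest p emin flp →
    ∀ a b c d : ℚ, IsFloat q emin a → IsFloat q emin b → IsFloat q emin c → IsFloat q emin d →
      0 ≤ a → 0 ≤ b → 0 ≤ c → 0 ≤ d →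
      a + b + c + d ≤ (1 + unitRoundoff p + 2 * unitRoundoff q + unitRoundoff p * unitRoundoff q)
        * flp (flq (flq (a + b) + flq (c + d)))

/-- `R4_DemotionBalanced4` holds. -/
theorem R4_DemotionBalanced4_holds : R4_DemotionBalanced4 :=
  fun _ _ hp hpq _ _ _ hflq hflp _ _ _ _ ha hb hc hd ha0 hb0 hc0 hd0 =>
    exact_le_demotion_balanced4 hp hpq hflq hflp ha hb hc hd ha0 hb0 hc0 hd0

end Summit.Ventures.CertifiedArithmetic.LowPrec.Opt
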